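import Mathlib
import Literature.AlgebraicGeometry.Resolution.CobordantGame
import Literature.AlgebraicGeometry.Resolution.CobordantChartCoefficients
import Literature.AlgebraicGeometry.Resolution.CobordantChartPlaneSlice
import Literature.AlgebraicGeometry.Resolution.AxisPolyhedron
import Summits.ResolutionOfSingularities.ResolutionOfSingularities.Theorems.WeightedInvariantLocalWeightedDropAxisPointMove
import Summits.ResolutionOfSingularities.ResolutionOfSingularities.Theorems.WeightedInvariantLocalWeightedDropAxisPreparationTaylor
import Summits.ResolutionOfSingularities.ResolutionOfSingularities.Theorems.WeightedInvariantLocalWeightedDropAxisNearDescentCoeff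

/-!
# `LocalWeightedDrop` (stmt-ResolutionOfSingularities-8899), TOT2-LINE piece S-E1 (core, part 2):
# the NEAR point blow-up preserves the axis normal form and Hironaka preparedness

Route `ResolutionOfSingularities/WeightedInvariant`, crux `LocalWeightedDrop`, registered residual
`stub_spaceNCRankDrop` (skeleton v32), sub-line TOT2-LINE v1 §5 (E1) [OURS · L1 W4.3; AI-drafted, weaker than
expert review].  Continuation of `…AxisNearDescentCoeff` (same setting and the same hypothesis
`hN : N = rename ⇑(finRotate (n+1)).symm Sl` naming the near successor at the axis point in axis coordinates).

**Results** (def-free, every field, every dimension `n + 1`):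
* `initEval_nearSucc_snoc_zero`, `trivialApexX_nearSucc` — on the hyperplane `z = 0` the degree-`d` forms agree,
  so the TRIVIAL APEX INSIDE `z = 0` is transported;
* `axisCone_nearSucc` — for `δ(S) > 2` the successor is again an AXIS GERM (`in_d N = F(x')`);
* `inAxisIdeal_nearSucc_iff` — `δ(N) = ∞ ↔ δ(S) = ∞`;
* `taylorCoeff_nearSucc`, **`solvable_nearSucc_iff`** (with `AxisWeightedMove.taylorCoeff_smul`) —
  `Solvable d M lam N ↔ Solvable d (M + 1) (c_z^{-(M+1)} · lam) S`;
* **`preparedAxis_nearSucc`** — Hironaka preparedness (`PreparedAxis`, delivered by B1 `stub_axisPreparation`)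
  SURVIVES the near blow-up: no re-preparation is needed along the fundamental sequence of an `e = 1` point,
  and with `aboveLevel_nearSucc_iff` the invariant `δ` drops by exactly one at each of its steps until
  `δ < 2`, where B3's computation (`AxisPointMove.order_axisSlice_lt`) ends it (CJS Lemma 9.3-type computation).
Deliberately NOT here: the decorated (boundary/history) statement of (E1) on the S-SET `Decoration`s, and the
`δ = 2` boundary case (successor apex-free) — sequel.
-/

set_option linter.dupNamespace false -- mandated namespace of this single-conjunct summit

namespace Summit.ResolutionOfSingularities.ResolutionOfSingularities.Theorems

open Literature.AlgebraicGeometry.Resolution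

namespace AxisNearDescent

open MvPowerSeries AxisPolyhedron

variable {k : Type} [Field k] {n : ℕ}
/-! ### The form `F(x')`, the axis cone and the trivial apex are transported -/

/-- On the hyperplane `z = 0` the degree-`d` forms of `N` and `S` take the same values. -/
theorem initEval_nearSucc_snoc_zero {S : MvPowerSeries (Fin (n + 1)) k} {c : Fin (n + 1) → k}
    (hc : ∀ j : Fin n, c (Fin.castSucc j) = 0) {d : ℕ} {G : MvPowerSeries (Fin (n + 2)) k}
    (hfac : subst (CobordantChart.chart (fun _ : Fin (n + 1) => 1) c) S = X 0 ^ d * G)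
    {N : MvPowerSeries (Fin (n + 1)) k}
    (hN : N = rename (⇑(finRotate (n + 1)).symm)
      (subst (fun j : Fin (n + 2) => if j = (Fin.last n).succ then (0 : MvPowerSeries (Fin (n + 1)) k)
        else X (Fin.predAbove (Fin.last n) j)) G))
    (v : Fin n → k) :
    CobordantChart.initEval (fun _ : Fin (n + 1) => 1) (Fin.snoc v 0 : Fin (n + 1) → k) d N =
      CobordantChart.initEval (fun _ : Fin (n + 1) => 1) (Fin.snoc v 0 : Fin (n + 1) → k) d S := by
  rw [ApexFreeOrderDrop.initEval_one_eq_sum, ApexFreeOrderDrop.initEval_one_eq_sum]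
  refine Finset.sum_congr rfl fun e he => ?_
  have hdeg : e.degree = d := by
    rw [← ApexFreeOrderDrop.weight_one_eq_degree]
    exact (ApexFreeOrderDrop.mem_antidiag_iff d e).mp he
  by_cases hz : e (Fin.last n) = 0
  · rw [coeff_nearSucc_of_last_eq_zero hc hfac hN hdeg hz]
  · have hzero : ∏ i : Fin (n + 1), (Fin.snoc v 0 : Fin (n + 1) → k) i ^ e i = 0 :=
      Finset.prod_eq_zero (Finset.mem_univ (Fin.last n)) (by rw [Fin.snoc_last, zero_pow hz])
    rw [hzero, mul_zero, mul_zero]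

/-- **THE TRIVIAL APEX INSIDE `z = 0` IS TRANSPORTED** to the near successor. -/
theorem trivialApexX_nearSucc {S : MvPowerSeries (Fin (n + 1)) k} {c : Fin (n + 1) → k}
    (hc : ∀ j : Fin n, c (Fin.castSucc j) = 0) {d : ℕ} {G : MvPowerSeries (Fin (n + 2)) k}
    (hfac : subst (CobordantChart.chart (fun _ : Fin (n + 1) => 1) c) S = X 0 ^ d * G)
    {N : MvPowerSeries (Fin (n + 1)) k}
    (hN : N = rename (⇑(finRotate (n + 1)).symm)
      (subst (fun j : Fin (n + 2) => if j = (Fin.last n).succ then (0 : MvPowerSeries (Fin (n + 1)) k)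
        else X (Fin.predAbove (Fin.last n) j)) G))
    (hapex : TrivialApexX d S) : TrivialApexX d N := by
  intro u hu
  obtain ⟨v, hv⟩ := hapex u hu
  refine ⟨v, ?_⟩
  rw [AxisWeightedMove.snoc_add_snoc] at hv ⊢
  rwa [initEval_nearSucc_snoc_zero hc hfac hN, initEval_nearSucc_snoc_zero hc hfac hN]

/-- **FOR `δ(S) > 2` THE SUCCESSOR IS AGAIN AN AXIS GERM**: its degree-`d` part involves no `z`. -/
theorem axisCone_nearSucc {S : MvPowerSeries (Fin (n + 1)) k} {c : Fin (n + 1) → k}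
    (hc : ∀ j : Fin n, c (Fin.castSucc j) = 0) {d : ℕ} {G : MvPowerSeries (Fin (n + 2)) k}
    (hfac : subst (CobordantChart.chart (fun _ : Fin (n + 1) => 1) c) S = X 0 ^ d * G)
    {N : MvPowerSeries (Fin (n + 1)) k}
    (hN : N = rename (⇑(finRotate (n + 1)).symm)
      (subst (fun j : Fin (n + 2) => if j = (Fin.last n).succ then (0 : MvPowerSeries (Fin (n + 1)) k)
        else X (Fin.predAbove (Fin.last n) j)) G))
    {r q : ℕ} (hlev : AboveLevel d r q S) (hrq : 2 * q < r) : AxisCone d N := by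
  intro E hdeg hz
  have hsum := AxisPreparation.degree_eq_xDeg_add E
  rw [coeff_nearSucc hc hfac hN (by omega), hlev _ (by rw [xDeg_update_last]; omega) ?_, zero_mul]
  rw [xDeg_update_last, update_last_apply_last]
  have h1 : E (Fin.last n) + d - xDeg E = 2 * E (Fin.last n) := by omega
  have h2 : d - xDeg E = E (Fin.last n) := by omega
  rw [h1, h2, ← Nat.mul_assoc]
  exact Nat.mul_lt_mul_of_pos_right (by omega) (Nat.pos_of_ne_zero hz)

/-- **`δ = ∞` IS TRANSPORTED BOTH WAYS**: `N ∈ (x')^d ↔ S ∈ (x')^d` (source of order `≥ d`, `c_z ≠ 0`). -/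
theorem inAxisIdeal_nearSucc_iff {S : MvPowerSeries (Fin (n + 1)) k} {c : Fin (n + 1) → k}
    (hc : ∀ j : Fin n, c (Fin.castSucc j) = 0) (hcz : c (Fin.last n) ≠ 0) {d : ℕ}
    {G : MvPowerSeries (Fin (n + 2)) k}
    (hfac : subst (CobordantChart.chart (fun _ : Fin (n + 1) => 1) c) S = X 0 ^ d * G)
    {N : MvPowerSeries (Fin (n + 1)) k}
    (hN : N = rename (⇑(finRotate (n + 1)).symm)
      (subst (fun j : Fin (n + 2) => if j = (Fin.last n).succ then (0 : MvPowerSeries (Fin (n + 1)) k)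
        else X (Fin.predAbove (Fin.last n) j)) G))
    (hord : ∀ E : Fin (n + 1) →₀ ℕ, coeff E S ≠ 0 → d ≤ E.degree) :
    InAxisIdeal d N ↔ InAxisIdeal d S := by
  constructor
  · intro h E₀ hx₀
    by_contra hne
    have hd := hord E₀ hne
    have hzero := h (E₀.update (Fin.last n) (E₀.degree - d)) (by rw [xDeg_update_last]; exact hx₀)
    rw [coeff_nearSucc_update hc hfac hN hd] at hzero
    exact mul_ne_zero hne (pow_ne_zero _ hcz) hzero
  · intro h E hx
    rw [coeff_nearSucc hc hfac hN (by omega), h _ (by rw [xDeg_update_last]; exact hx), zero_mul]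

/-! ### Hasse–Taylor coefficients, solvable vertices and preparedness are transported -/

/-- The Hasse–Taylor coefficients (which only read the `z`-free degree-`d` part `F(x')`) are unchanged. -/
theorem taylorCoeff_nearSucc {S : MvPowerSeries (Fin (n + 1)) k} {c : Fin (n + 1) → k}
    (hc : ∀ j : Fin n, c (Fin.castSucc j) = 0) {d : ℕ} {G : MvPowerSeries (Fin (n + 2)) k}
    (hfac : subst (CobordantChart.chart (fun _ : Fin (n + 1) => 1) c) S = X 0 ^ d * G)
    {N : MvPowerSeries (Fin (n + 1)) k}
    (hN : N = rename (⇑(finRotate (n + 1)).symm)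
      (subst (fun j : Fin (n + 2) => if j = (Fin.last n).succ then (0 : MvPowerSeries (Fin (n + 1)) k)
        else X (Fin.predAbove (Fin.last n) j)) G))
    (lam : Fin n → k) (E : Fin (n + 1) →₀ ℕ) : taylorCoeff d N lam E = taylorCoeff d S lam E := by
  rw [AxisPreparation.taylorCoeff_eq_sum, AxisPreparation.taylorCoeff_eq_sum]
  refine Finset.sum_congr rfl fun B hB => ?_
  obtain ⟨hdeg, hz⟩ := AxisPreparation.mem_axisExps.mp hB
  rw [coeff_nearSucc_of_last_eq_zero hc hfac hN hdeg hz]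

/-- **SOLVABLE VERTICES CORRESPOND**: the vertex of `N` at the integer level `M` is solved by `lam` iff the
vertex of `S` at the level `M + 1` is solved by `c_z^{-(M+1)} · lam`. -/
theorem solvable_nearSucc_iff {S : MvPowerSeries (Fin (n + 1)) k} {c : Fin (n + 1) → k}
    (hc : ∀ j : Fin n, c (Fin.castSucc j) = 0) (hcz : c (Fin.last n) ≠ 0) {d : ℕ}
    {G : MvPowerSeries (Fin (n + 2)) k}
    (hfac : subst (CobordantChart.chart (fun _ : Fin (n + 1) => 1) c) S = X 0 ^ d * G)
    {N : MvPowerSeries (Fin (n + 1)) k}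
    (hN : N = rename (⇑(finRotate (n + 1)).symm)
      (subst (fun j : Fin (n + 2) => if j = (Fin.last n).succ then (0 : MvPowerSeries (Fin (n + 1)) k)
        else X (Fin.predAbove (Fin.last n) j)) G))
    (hord : ∀ E : Fin (n + 1) →₀ ℕ, coeff E S ≠ 0 → d ≤ E.degree) (M : ℕ) (lam : Fin n → k) :
    Solvable d M lam N ↔ Solvable d (M + 1) (((c (Fin.last n))⁻¹ ^ (M + 1)) • lam) S := by
  -- the pointwise correspondence between the two vertex conditions
  have key : ∀ E : Fin (n + 1) →₀ ℕ, xDeg E < d → E (Fin.last n) = M * (d - xDeg E) →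
      (coeff E N = taylorCoeff d N lam E ↔
        coeff (E.update (Fin.last n) (E (Fin.last n) + d - xDeg E)) S =
          taylorCoeff d S (((c (Fin.last n))⁻¹ ^ (M + 1)) • lam)
            (E.update (Fin.last n) (E (Fin.last n) + d - xDeg E))) := by
    intro E hx hz
    have hγ : E (Fin.last n) + d - xDeg E = (M + 1) * (d - xDeg E) := by
      rw [hz, Nat.add_mul, one_mul]; omega
    rw [coeff_nearSucc hc hfac hN (by omega), taylorCoeff_nearSucc hc hfac hN,
      AxisWeightedMove.taylorCoeff_smul _ _ _ _ _ (by rw [xDeg_update_last]; exact hx.le),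
      xDeg_update_last, AxisPreparation.taylorCoeff_congr (E' := E) (fun j => update_last_apply_castSucc E _ j),
      hγ, ← pow_mul, inv_pow]
    have hcγ : c (Fin.last n) ^ ((M + 1) * (d - xDeg E)) ≠ 0 := pow_ne_zero _ hcz
    constructor
    · intro h
      rw [← h]
      field_simp
    · intro h
      rw [h]
      field_simp
  constructor
  · rintro ⟨hlevN, hN'⟩
    refine ⟨(aboveLevel_nearSucc_iff hc hcz hfac hN hord M 1).mp hlevN, fun E₀ hx₀ hz₀ => ?_⟩
    -- pull `E₀` back to the exponent `E` of `N`
    have hdeg := AxisPreparation.degree_eq_xDeg_add E₀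
    have hd : d ≤ E₀.degree := by rw [hdeg, hz₀, Nat.add_mul, one_mul]; omega
    set E := E₀.update (Fin.last n) (E₀.degree - d) with hE
    have hxE : xDeg E = xDeg E₀ := xDeg_update_last _ _
    have hzE : E (Fin.last n) = M * (d - xDeg E) := by
      rw [hE, update_last_apply_last, hxE, hdeg, hz₀, Nat.add_mul, one_mul]; omega
    have hback : E.update (Fin.last n) (E (Fin.last n) + d - xDeg E) = E₀ := by
      rw [hE, update_last_update_last, update_last_apply_last, xDeg_update_last]
      exact update_last_eq_self (by omega)
    have h := (key E (by rw [hxE]; exact hx₀) hzE).mp (hN' E (by rw [hxE]; exact hx₀) hzE)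
    rwa [hback] at h
  · rintro ⟨hlevS, hS'⟩
    refine ⟨(aboveLevel_nearSucc_iff hc hcz hfac hN hord M 1).mpr hlevS, fun E hx hz => ?_⟩
    refine (key E hx hz).mpr (hS' _ (by rw [xDeg_update_last]; exact hx) ?_)
    rw [update_last_apply_last, xDeg_update_last, hz, Nat.add_mul, one_mul]
    omega

/-- **PREPAREDNESS SURVIVES THE NEAR BLOW-UP** (no re-preparation along the fundamental sequence): if no
non-zero vector solves any integer vertex of `S`, the same holds for `N`. -/
theorem preparedAxis_nearSucc {S : MvPowerSeries (Fin (n + 1)) k} {c : Fin (n + 1) → k}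
    (hc : ∀ j : Fin n, c (Fin.castSucc j) = 0) (hcz : c (Fin.last n) ≠ 0) {d : ℕ}
    {G : MvPowerSeries (Fin (n + 2)) k}
    (hfac : subst (CobordantChart.chart (fun _ : Fin (n + 1) => 1) c) S = X 0 ^ d * G)
    {N : MvPowerSeries (Fin (n + 1)) k}
    (hN : N = rename (⇑(finRotate (n + 1)).symm)
      (subst (fun j : Fin (n + 2) => if j = (Fin.last n).succ then (0 : MvPowerSeries (Fin (n + 1)) k)
        else X (Fin.predAbove (Fin.last n) j)) G))
    (hord : ∀ E : Fin (n + 1) →₀ ℕ, coeff E S ≠ 0 → d ≤ E.degree) (hprep : PreparedAxis d S) :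
    PreparedAxis d N := by
  intro M lam hlam hsol
  refine hprep (M + 1) (((c (Fin.last n))⁻¹ ^ (M + 1)) • lam) ?_
    ((solvable_nearSucc_iff hc hcz hfac hN hord M lam).mp hsol)
  intro hzero
  apply hlam
  rw [smul_eq_zero] at hzero
  rcases hzero with h0 | h
  · exact absurd h0 (pow_ne_zero _ (inv_ne_zero hcz))
  · exact h

end AxisNearDescent

end Summit.ResolutionOfSingularities.ResolutionOfSingularities.Theorems
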